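import Mathlib
import HarnessLib
import Summits.Parity.GeneralizedHardyLittlewood.Theorems.DilatedChowla.Negative.DilatedChowlaMirrorOnePointDefs
import Literature.NumberTheory.LFunctions.LiouvilleCharSumLinnikBox
import Literature.Probability.RandomPlanarGeometry.ConformalRemovabilityShadows

/-!
# `DilatedChowla` (stmt-Parity-13319): transfer of the Möbius laws to the Liouville twisted sums

Part of the analytic stub of the line `Sketch` (card `siegel-mirror`) for the crux `LiouvilleMAD.DilatedChowla`.
This file proves `MoebiusLaws → CharTwist` (`charTwist_of_moebiusLaws`): the exceptional-zero laws for the twisted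
Möbius sums `Mtw Ξ x = Σ_{n ≤ x} μ(n) Ξ(n)` (`MoebiusExcLaw`, `MoebiusNonexcLaw`) imply the per-character law
`CharTwistLaw` for the twisted Liouville sums `B Ξ y = Σ_{u ≤ y} λ(u) Ξ(u)`, through the exact identity
`λ = 𝟙_□ ∗ μ` (tree `LiouvilleCharSumLinnikBox.sum_liouville_twist_eq`): `B Ξ y = Σ_{r ≤ √y} Ξ(r²) · Mtw Ξ (y/r²)`.
For the exceptional real character `ψ`, `ψ(r²) = [(r,k) = 1]`; inserting `Mtw ψ x = x^β/(β L'(β,ψ)) + O(x/k⁶)` for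
`r ≤ 8k⁴` and trivial bounds for `r > 8k⁴` gives the main term `R · y^β/β`, `R = (Σ_{(r,k)=1} r^{-2β}) / L'(β,ψ)
≥ 1/L'(β,ψ)`; the tail `Σ_{r > √y} r^{-2β} ≤ Σ_{r > √y} r^{-3/2} ≤ 2/y^{1/4}` comes from the telescoping bound
`1/(t√t) ≤ 2/√(t-1) − 2/√t` (tree `Literature.Probability.RandomPlanarGeometry.one_div_mul_sqrt_le`).  For `Ξ ≠ ψ`
there is no main term.  All errors are absorbed in `(R + 1) y/k⁴` once `y ≥ exp((C₁ + 30)(1 + log k)²)`.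
-/

noncomputable section

namespace Summit.Parity.GeneralizedHardyLittlewood.Theorems.DilatedChowla.Negative

open Finset Literature.NumberTheory.LFunctions
open scoped Classical ArithmeticFunction.Moebius

/-! ## §1 The identity `B Ξ y = Σ_{r ≤ √⌊y⌋} Ξ(r²) · Mtw Ξ (y/r²)` and trivial bounds -/

/-- `Mtw Ξ (y/r²)` is the inner Möbius sum of the convolution identity at `⌊y⌋/r²` (`⌊y/r²⌋ = ⌊y⌋/r²`). -/
theorem tr_Mtw_div_sq_eq {k : ℕ} (Ξ : DirichletCharacter ℂ k) (y : ℝ) (r : ℕ) :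
    Mtw Ξ (y / (r : ℝ) ^ 2) = ∑ m ∈ Ioc 0 (⌊y⌋₊ / (r * r)), Ξ (m : ZMod k) * (μ m : ℂ) := by
  unfold Mtw
  rw [show ((r : ℝ)) ^ 2 = ((r * r : ℕ) : ℝ) by push_cast; ring, Nat.floor_div_natCast]
  exact Finset.sum_congr rfl fun m _ => mul_comm _ _

/-- **The convolution identity** `B Ξ y = Σ_{0 < r ≤ √⌊y⌋} Ξ(r²) · Mtw Ξ (y/r²)` (`λ = 𝟙_□ ∗ μ`). -/
theorem tr_B_eq_sum {k : ℕ} (Ξ : DirichletCharacter ℂ k) (y : ℝ) :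
    B Ξ y = ∑ r ∈ Ioc 0 (Nat.sqrt ⌊y⌋₊), Ξ ((r * r : ℕ) : ZMod k) * Mtw Ξ (y / (r : ℝ) ^ 2) := by
  unfold B
  rw [LiouvilleCharSumLinnikBox.sum_liouville_twist_eq]
  calc ∑ s ∈ Ioc 0 ⌊y⌋₊, (if IsSquare s then (1 : ℂ) else 0) * Ξ (s : ZMod k) *
          ∑ m ∈ Ioc 0 (⌊y⌋₊ / s), Ξ (m : ZMod k) * (μ m : ℂ)
      = ∑ s ∈ Ioc 0 ⌊y⌋₊, (if IsSquare s then
          Ξ (s : ZMod k) * ∑ m ∈ Ioc 0 (⌊y⌋₊ / s), Ξ (m : ZMod k) * (μ m : ℂ) else 0) := by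
        refine sum_congr rfl fun s _ => ?_
        split_ifs <;> simp
    _ = ∑ s ∈ (Ioc 0 ⌊y⌋₊).filter IsSquare,
          Ξ (s : ZMod k) * ∑ m ∈ Ioc 0 (⌊y⌋₊ / s), Ξ (m : ZMod k) * (μ m : ℂ) :=
        (sum_filter _ _).symm
    _ = _ := by
        rw [SiegelWalfiszLiouville.filter_isSquare_Ioc_eq_image, sum_image fun r₁ _ r₂ _ h => Nat.mul_self_inj.mp h]
        exact sum_congr rfl fun r _ => by rw [tr_Mtw_div_sq_eq]

/-- The trivial bound `‖Mtw Ξ x‖ ≤ ⌊x⌋ ≤ x` for `x ≥ 0`. -/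
theorem tr_norm_Mtw_le {k : ℕ} (Ξ : DirichletCharacter ℂ k) {x : ℝ} (hx : 0 ≤ x) : ‖Mtw Ξ x‖ ≤ x := by
  refine le_trans ?_ (Nat.floor_le hx)
  unfold Mtw
  calc ‖∑ n ∈ Icc 1 ⌊x⌋₊, (μ n : ℂ) * Ξ (n : ZMod k)‖ ≤ ∑ n ∈ Icc 1 ⌊x⌋₊, ‖(μ n : ℂ) * Ξ (n : ZMod k)‖ := norm_sum_le _ _
    _ ≤ ∑ _n ∈ Icc 1 ⌊x⌋₊, (1 : ℝ) :=
        sum_le_sum fun n _ => by rw [mul_comm]; exact MoebiusCharSumLinnikBox.norm_twist_moebius_le Ξ n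
    _ = ⌊x⌋₊ := by simp

/-- For a real character `ψ` (`ψ² = 1`): `ψ(r²) = [(r,k) = 1]`. -/
theorem tr_psi_sq_apply {k : ℕ} {ψ : DirichletCharacter ℂ k} (hψ2 : ψ ^ 2 = 1) (r : ℕ) :
    ψ ((r * r : ℕ) : ZMod k) = if r.Coprime k then 1 else 0 := by
  have h : ψ ((r * r : ℕ) : ZMod k) = (ψ ^ 2) (r : ZMod k) := by
    rw [MulChar.pow_apply' ψ two_ne_zero, Nat.cast_mul, map_mul, sq]
  rw [h, hψ2]
  by_cases hr : r.Coprime k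
  · rw [if_pos hr, MulChar.one_apply ((ZMod.isUnit_iff_coprime r k).2 hr)]
  · rw [if_neg hr, MulChar.map_nonunit _ (mt (ZMod.isUnit_iff_coprime r k).1 hr)]

/-! ## §2 The tail `Σ_{r > M} r^{-2β} ≤ 2/√M` -/

/-- `u^{-2β} ≤ 1/(u√u)` for `u ≥ 1` and `β ≥ 3/4`. -/
theorem tr_rpow_le_inv_mul_sqrt {u β : ℝ} (hu : 1 ≤ u) (hβ : 3 / 4 ≤ β) :
    u ^ (-(2 * β)) ≤ 1 / (u * Real.sqrt u) := by
  have hu0 : 0 < u := by linarith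
  calc u ^ (-(2 * β)) ≤ u ^ (-(3 / 2 : ℝ)) := Real.rpow_le_rpow_of_exponent_le hu (by linarith)
    _ = 1 / (u * Real.sqrt u) := by
      rw [Real.rpow_neg hu0.le, show (3 / 2 : ℝ) = 1 + 1 / 2 by norm_num, Real.rpow_add hu0,
        Real.rpow_one, Real.sqrt_eq_rpow, one_div (u * _)]

/-- **Tail bound.** If `0 ≤ g n ≤ n^{-2β}` with `β ≥ 3/4`, then `Σ_{n > M} g n ≤ 2/√M` (`M ≥ 1`), by the
telescoping `1/(t√t) ≤ 2/√(t-1) − 2/√t` (tree `RandomPlanarGeometry.one_div_mul_sqrt_le`). -/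
theorem tr_tail_le {g : ℕ → ℝ} {β : ℝ} (hβ : 3 / 4 ≤ β) (hg0 : ∀ n, 0 ≤ g n)
    (hg : ∀ n, g n ≤ (n : ℝ) ^ (-(2 * β))) {M : ℕ} (hM : 1 ≤ M) :
    ∑' i, g (i + (M + 1)) ≤ 2 / Real.sqrt M := by
  refine Real.tsum_le_of_sum_range_le (fun n => hg0 _) fun n => ?_
  have hterm : ∀ i : ℕ, g (i + (M + 1)) ≤
      2 / Real.sqrt ((i + M : ℕ) : ℝ) - 2 / Real.sqrt ((i + 1 + M : ℕ) : ℝ) := by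
    intro i
    have h1 : (1 : ℝ) ≤ ((i + (M + 1) : ℕ) : ℝ) := by exact_mod_cast (by omega : 1 ≤ i + (M + 1))
    have h2 : (2 : ℝ) ≤ ((i + (M + 1) : ℕ) : ℝ) := by exact_mod_cast (by omega : 2 ≤ i + (M + 1))
    calc g (i + (M + 1)) ≤ ((i + (M + 1) : ℕ) : ℝ) ^ (-(2 * β)) := hg _
      _ ≤ 1 / (((i + (M + 1) : ℕ) : ℝ) * Real.sqrt ((i + (M + 1) : ℕ) : ℝ)) := tr_rpow_le_inv_mul_sqrt h1 hβ
      _ ≤ 2 / Real.sqrt (((i + (M + 1) : ℕ) : ℝ) - 1) - 2 / Real.sqrt ((i + (M + 1) : ℕ) : ℝ) :=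
          Literature.Probability.RandomPlanarGeometry.one_div_mul_sqrt_le h2
      _ = _ := by congr 3 <;> push_cast <;> ring
  calc ∑ i ∈ range n, g (i + (M + 1))
      ≤ ∑ i ∈ range n, (2 / Real.sqrt ((i + M : ℕ) : ℝ) - 2 / Real.sqrt ((i + 1 + M : ℕ) : ℝ)) := sum_le_sum fun i _ => hterm i
    _ = 2 / Real.sqrt ((0 + M : ℕ) : ℝ) - 2 / Real.sqrt ((n + M : ℕ) : ℝ) :=
        Finset.sum_range_sub' (fun i => 2 / Real.sqrt ((i + M : ℕ) : ℝ)) n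
    _ ≤ 2 / Real.sqrt M := by
        have : 0 ≤ 2 / Real.sqrt ((n + M : ℕ) : ℝ) := by positivity
        rw [zero_add]; linarith

/-! ## §3 Numerical bookkeeping -/

/-- `2^a · k^n ≤ exp((a + n)(1 + log k)²)` for `k ≥ 1`. -/
theorem tr_two_pow_mul_pow_le {k : ℕ} (hk : 1 ≤ k) (a n : ℕ) :
    (2 : ℝ) ^ a * (k : ℝ) ^ n ≤ Real.exp ((a + n) * (1 + Real.log k) ^ 2) := by
  have hk0 : (0 : ℝ) < k := by exact_mod_cast hk
  have hlog : 0 ≤ Real.log k := Real.log_nonneg (by exact_mod_cast hk)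
  have hℓ1 : 1 ≤ 1 + Real.log k := by linarith
  have h2 : (2 : ℝ) ≤ Real.exp (1 + Real.log k) := by linarith [Real.add_one_le_exp (1 + Real.log k)]
  have hk' : (k : ℝ) ≤ Real.exp (1 + Real.log k) := by
    calc (k : ℝ) = Real.exp (Real.log k) := (Real.exp_log hk0).symm
      _ ≤ Real.exp (1 + Real.log k) := Real.exp_le_exp.2 (by linarith)
  calc (2 : ℝ) ^ a * (k : ℝ) ^ n ≤ Real.exp (1 + Real.log k) ^ a * Real.exp (1 + Real.log k) ^ n :=
        mul_le_mul (pow_le_pow_left₀ (by norm_num) h2 a) (pow_le_pow_left₀ hk0.le hk' n) (by positivity) (by positivity)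
    _ = Real.exp ((a + n : ℕ) * (1 + Real.log k)) := by rw [← pow_add, Real.exp_nat_mul]
    _ ≤ Real.exp ((a + n) * (1 + Real.log k) ^ 2) := by
        rw [Real.exp_le_exp]; push_cast
        have : (1 + Real.log k) ≤ (1 + Real.log k) ^ 2 := by nlinarith
        exact mul_le_mul_of_nonneg_left this (by positivity)

/-- For `0 < r ≤ 8k⁴` and `64 k⁸ X₀ ≤ y`: `X₀ ≤ y/r²` (the Möbius laws apply at `y/r²`). -/
theorem tr_X₀_le_div {k r : ℕ} {y X₀ : ℝ} (hr0 : 0 < r) (hr : r ≤ 8 * k ^ 4) (hX₀ : 0 ≤ X₀) (hy : 64 * (k : ℝ) ^ 8 * X₀ ≤ y) :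
    X₀ ≤ y / (r : ℝ) ^ 2 := by
  have hr0' : (0 : ℝ) < r := by exact_mod_cast hr0
  have hr' : (r : ℝ) ≤ 8 * (k : ℝ) ^ 4 := by exact_mod_cast hr
  rw [le_div_iff₀ (by positivity)]
  calc X₀ * (r : ℝ) ^ 2 ≤ X₀ * (8 * (k : ℝ) ^ 4) ^ 2 := by gcongr
    _ = 64 * (k : ℝ) ^ 8 * X₀ := by ring
    _ ≤ y := hy

/-- For `0 < r ≤ √⌊y⌋` (`y ≥ 0`): `1 ≤ y/r²`. -/
theorem tr_one_le_div {r : ℕ} {y : ℝ} (hy : 0 ≤ y) (hr : r ∈ Ioc 0 (Nat.sqrt ⌊y⌋₊)) : 1 ≤ y / (r : ℝ) ^ 2 := by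
  rw [mem_Ioc] at hr
  have hr0 : (0 : ℝ) < r := by exact_mod_cast hr.1
  have h1 : r * r ≤ ⌊y⌋₊ := Nat.le_sqrt.1 hr.2
  have h2 : ((r * r : ℕ) : ℝ) ≤ y := le_trans (by exact_mod_cast h1) (Nat.floor_le hy)
  rw [le_div_iff₀ (by positivity), one_mul]
  calc ((r : ℝ)) ^ 2 = ((r * r : ℕ) : ℝ) := by push_cast; ring
    _ ≤ y := h2

/-! ## §4 The two regimes `r ≤ 8k⁴` (the laws) and `r > 8k⁴` (trivial bounds) -/

/-- Summation over `0 < r ≤ √⌊y⌋` of the per-`r` errors: the law `‖Mtw Ξ (y/r²) − p r‖ ≤ (y/r²)/k⁶`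
for `r ≤ 8k⁴` and the trivial bounds `‖Mtw Ξ (y/r²)‖ ≤ y/r²`, `|p r| ≤ (2/L') y/r²` beyond give
`Σ_r ‖Mtw Ξ (y/r²) − p r‖ ≤ 2y/k⁶ + (1 + 2/L') y/(8k⁴)` (`Σ 1/r² ≤ 2`, `Σ_{r > R₀} 1/r² ≤ 1/R₀`). -/
theorem tr_sum_norm_sub_le {k : ℕ} [NeZero k] (Ξ : DirichletCharacter ℂ k) {y L' : ℝ} (p : ℕ → ℝ) (hy : 0 ≤ y)
    (hL' : 0 < L') (hp : ∀ r ∈ Ioc 0 (Nat.sqrt ⌊y⌋₊), |p r| ≤ 2 / L' * (y / (r : ℝ) ^ 2))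
    (hlaw : ∀ r ∈ Ioc 0 (Nat.sqrt ⌊y⌋₊), r ≤ 8 * k ^ 4 → ‖Mtw Ξ (y / (r : ℝ) ^ 2) - p r‖ ≤ y / (r : ℝ) ^ 2 / (k : ℝ) ^ 6) :
    ∑ r ∈ Ioc 0 (Nat.sqrt ⌊y⌋₊), ‖Mtw Ξ (y / (r : ℝ) ^ 2) - p r‖ ≤
      2 * (y / (k : ℝ) ^ 6) + (1 + 2 / L') * y * (1 / (8 * (k : ℝ) ^ 4)) := by
  have hR₀ : 1 ≤ 8 * k ^ 4 := le_trans (Nat.one_le_pow 4 k NeZero.one_le) (Nat.le_mul_of_pos_left _ (by norm_num))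
  have h := LiouvilleCharSumLinnikBox.sum_two_regimes_le (f := fun r => ‖Mtw Ξ (y / (r : ℝ) ^ 2) - p r‖)
    (S := Nat.sqrt ⌊y⌋₊) (R₀ := 8 * k ^ 4) (A := y / (k : ℝ) ^ 6) (Nr := (1 + 2 / L') * y) hR₀ (by positivity)
    (by positivity) ?_ ?_
  · rw [show ((8 * k ^ 4 : ℕ) : ℝ) = 8 * (k : ℝ) ^ 4 by push_cast; ring] at h
    exact h
  · intro r hr hr8
    have hr0 : (0 : ℝ) < r := by exact_mod_cast (mem_Ioc.1 hr).1
    calc ‖Mtw Ξ (y / (r : ℝ) ^ 2) - p r‖ ≤ y / (r : ℝ) ^ 2 / (k : ℝ) ^ 6 := hlaw r hr hr8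
      _ = y / (k : ℝ) ^ 6 * (1 / (r : ℝ) ^ 2) := by ring
  · intro r hr
    have hr' : r ∈ Ioc 0 (Nat.sqrt ⌊y⌋₊) := by
      rw [mem_Ioc] at hr ⊢
      exact ⟨lt_of_le_of_lt (Nat.zero_le _) hr.1, hr.2⟩
    have hr0 : (0 : ℝ) < r := by exact_mod_cast (mem_Ioc.1 hr').1
    calc ‖Mtw Ξ (y / (r : ℝ) ^ 2) - p r‖ ≤ ‖Mtw Ξ (y / (r : ℝ) ^ 2)‖ + ‖((p r : ℝ) : ℂ)‖ := norm_sub_le _ _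
      _ ≤ y / (r : ℝ) ^ 2 + 2 / L' * (y / (r : ℝ) ^ 2) := by
          rw [Complex.norm_real, Real.norm_eq_abs]
          exact add_le_add (tr_norm_Mtw_le Ξ (by positivity)) (hp r hr')
      _ = (1 + 2 / L') * y * (1 / (r : ℝ) ^ 2) := by ring

/-! ## §5 The transfer -/

/-- **The transfer at explicit constants.**  If the Möbius laws hold with constants `c₁ ≤ 1/4`, `C₁`, `C₂`, then
the per-character Liouville law holds with constants `c₁`, `C₁ + 30`, `C₂`: for the exceptional zero `β` of
`ψ mod k` the main-term constant is `R = S/L'(β,ψ)` with `S = Σ_{(r,k)=1} r^{-2β} ≥ 1`. -/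
theorem tr_charTwistLaw {c₁ C₁ C₂ : ℝ} (hC₁ : 0 < C₁) (hC₂ : 0 < C₂) (hc0 : 0 < c₁) (hc : c₁ ≤ 1 / 4)
    (hE : MoebiusExcLaw c₁ C₁ C₂) (hN : MoebiusNonexcLaw c₁ C₁) : CharTwistLaw c₁ (C₁ + 30) C₂ := by
  intro k _ ψ hψ hψ2 β hβ hβ1 hL
  -- level `k = 1` carries no nontrivial character, so `k ≥ 2`
  by_cases hk2 : 2 ≤ k
  swap
  · obtain rfl : k = 1 := by have := NeZero.ne k; omega
    exact absurd (DirichletCharacter.level_one ψ) hψ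
  have hk1 : 1 ≤ k := by omega
  have hkr : (2 : ℝ) ≤ k := by exact_mod_cast hk2
  have hk0 : (0 : ℝ) < k := by positivity
  -- `β ≥ 3/4`
  have hlog4k : 1 ≤ Real.log (4 * k) := by
    rw [Real.le_log_iff_exp_le (by positivity)]
    linarith [Real.exp_one_lt_d9]
  have hβ34 : 3 / 4 ≤ β := by
    have : c₁ / Real.log (4 * k) ≤ 1 / 4 := (div_le_self hc0.le hlog4k).trans hc
    linarith
  have hβ0 : 0 < β := by linarith
  -- the Möbius laws at `k, ψ, β`; `L' = L'(β,ψ)`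
  obtain ⟨hL'0, hL'le, hExc⟩ := hE k ψ hψ hψ2 β hβ hβ1 hL
  have hNon := hN k ψ hψ hψ2 β hβ hβ1 hL
  set L' := (deriv ψ.LFunction (β : ℂ)).re with hL'def
  have hL'ne : L' ≠ 0 := hL'0.ne'
  -- the series `S = Σ_{(r,k)=1} r^{-2β}` and `R = S/L'`
  obtain ⟨g, hg⟩ : ∃ g : ℕ → ℝ, ∀ r, g r = if r.Coprime k then (r : ℝ) ^ (-(2 * β)) else 0 := ⟨_, fun r => rfl⟩
  have hg0 : ∀ r, 0 ≤ g r := fun r => by rw [hg]; split_ifs <;> positivity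
  have hgle : ∀ r, g r ≤ (r : ℝ) ^ (-(2 * β)) := fun r => by rw [hg]; split_ifs; exacts [le_rfl, by positivity]
  have hgs : Summable g := (Real.summable_nat_rpow.2 (by linarith : -(2 * β) < -1)).of_nonneg_of_le hg0 hgle
  have hg1 : g 1 = 1 := by rw [hg, if_pos (Nat.coprime_one_left k)]; simp
  have hg00 : g 0 = 0 := by
    rw [hg]; split_ifs
    exacts [by rw [Nat.cast_zero, Real.zero_rpow (by linarith : -(2 * β) ≠ 0)], rfl]
  obtain ⟨S, hS⟩ : ∃ S : ℝ, S = ∑' r, g r := ⟨_, rfl⟩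
  have hS1 : 1 ≤ S := by rw [hS, ← hg1]; exact hgs.le_tsum 1 fun j _ => hg0 j
  have hℓ1 : 1 ≤ 1 + Real.log k := by linarith [Real.log_nonneg (by linarith : (1 : ℝ) ≤ k)]
  refine ⟨S / L', ?_, fun Ξ y hy => ?_⟩
  · -- `R = S/L' ≥ 1/L' ≥ 1/(C₂ (1 + log k)²) ≥ 1/(C₂ (1 + log k)⁵)`
    calc 1 / (C₂ * (1 + Real.log k) ^ 5) ≤ 1 / (C₂ * (1 + Real.log k) ^ 2) := by
          apply one_div_le_one_div_of_le (by positivity)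
          exact mul_le_mul_of_nonneg_left (pow_le_pow_right₀ hℓ1 (by norm_num)) hC₂.le
      _ ≤ 1 / L' := one_div_le_one_div_of_le hL'0 hL'le
      _ ≤ S / L' := div_le_div_of_nonneg_right hS1 hL'0.le
  -- sizes: `y ≥ 64 k⁸ X₀`, `⌊y⌋ ≥ 1296 k¹⁶`, `√⌊y⌋ ≥ 36 k⁸`, `y ≥ 1`
  have hy64 : 64 * (k : ℝ) ^ 8 * Real.exp (C₁ * (1 + Real.log k) ^ 2) ≤ y := by
    refine le_trans ?_ hy
    have h1 := tr_two_pow_mul_pow_le hk1 6 8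
    calc 64 * (k : ℝ) ^ 8 * Real.exp (C₁ * (1 + Real.log k) ^ 2)
        = (2 : ℝ) ^ 6 * (k : ℝ) ^ 8 * Real.exp (C₁ * (1 + Real.log k) ^ 2) := by norm_num
      _ ≤ Real.exp ((6 + 8) * (1 + Real.log k) ^ 2) * Real.exp (C₁ * (1 + Real.log k) ^ 2) :=
          mul_le_mul_of_nonneg_right (by exact_mod_cast h1) (by positivity)
      _ = Real.exp ((C₁ + 14) * (1 + Real.log k) ^ 2) := by rw [← Real.exp_add]; ring_nf
      _ ≤ _ := Real.exp_le_exp.2 (mul_le_mul_of_nonneg_right (by linarith) (sq_nonneg _))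
  have hy1296 : (1296 : ℝ) * (k : ℝ) ^ 16 ≤ y := by
    refine le_trans ?_ hy
    have h1 := tr_two_pow_mul_pow_le hk1 11 16
    calc (1296 : ℝ) * (k : ℝ) ^ 16 ≤ (2 : ℝ) ^ 11 * (k : ℝ) ^ 16 := mul_le_mul_of_nonneg_right (by norm_num) (by positivity)
      _ ≤ Real.exp ((11 + 16) * (1 + Real.log k) ^ 2) := by exact_mod_cast h1
      _ ≤ _ := Real.exp_le_exp.2 (mul_le_mul_of_nonneg_right (by linarith) (sq_nonneg _))
  have hy1 : 1 ≤ y := by linarith [one_le_pow₀ (n := 16) (by linarith : (1 : ℝ) ≤ k)]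
  have hy0 : 0 ≤ y := by linarith
  have hN : 1296 * k ^ 16 ≤ ⌊y⌋₊ := Nat.le_floor (by exact_mod_cast hy1296)
  have hS₀ : 36 * k ^ 8 ≤ Nat.sqrt ⌊y⌋₊ := Nat.le_sqrt'.2 (le_trans (le_of_eq (by ring)) hN)
  have hS₀r : (36 : ℝ) * (k : ℝ) ^ 8 ≤ Nat.sqrt ⌊y⌋₊ := by exact_mod_cast hS₀
  have hS₀1 : 1 ≤ Nat.sqrt ⌊y⌋₊ := le_trans (le_trans (Nat.one_le_pow 8 k hk1) (Nat.le_mul_of_pos_left _ (by norm_num))) hS₀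
  have hsqrt : 6 * (k : ℝ) ^ 4 ≤ Real.sqrt (Nat.sqrt ⌊y⌋₊) := by
    rw [Real.le_sqrt' (by positivity)]
    calc (6 * (k : ℝ) ^ 4) ^ 2 = 36 * (k : ℝ) ^ 8 := by ring
      _ ≤ _ := hS₀r
  -- elementary pieces of the final bookkeeping (`u = y/k⁴`, `V = u/L'`)
  have hk6 : 2 * (y / (k : ℝ) ^ 6) ≤ y / (k : ℝ) ^ 4 / 2 := by
    have h4 : 1 / (k : ℝ) ^ 2 ≤ 1 / 4 := by rw [div_le_div_iff₀ (by positivity) (by norm_num)]; nlinarith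
    calc 2 * (y / (k : ℝ) ^ 6) = 2 * (y / (k : ℝ) ^ 4 * (1 / (k : ℝ) ^ 2)) := by ring
      _ ≤ 2 * (y / (k : ℝ) ^ 4 * (1 / 4)) := by gcongr
      _ = y / (k : ℝ) ^ 4 / 2 := by ring
  have hu0 : 0 ≤ y / (k : ℝ) ^ 4 := by positivity
  have hV0 : 0 ≤ y / (k : ℝ) ^ 4 / L' := by positivity
  have hVS : y / (k : ℝ) ^ 4 / L' ≤ S * (y / (k : ℝ) ^ 4 / L') := le_mul_of_one_le_left hV0 hS1
  have eA : (1 + 2 / L') * y * (1 / (8 * (k : ℝ) ^ 4)) = y / (k : ℝ) ^ 4 / 8 + y / (k : ℝ) ^ 4 / L' / 4 := by ring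
  have eR : (S / L' + 1) * y / (k : ℝ) ^ 4 = S * (y / (k : ℝ) ^ 4 / L') + y / (k : ℝ) ^ 4 := by ring
  -- the identity `B Ξ y = Σ_{r ≤ √⌊y⌋} Ξ(r²) Mtw Ξ (y/r²)`
  rw [tr_B_eq_sum]
  by_cases hΞ : Ξ = ψ
  · -- the exceptional character: main term `K₀ · S`, `K₀ = y^β/(β L')`
    rw [if_pos hΞ, hΞ]
    obtain ⟨K₀, hK₀def⟩ : ∃ K₀ : ℝ, K₀ = y ^ β / (β * L') := ⟨_, rfl⟩
    have hK₀0 : 0 ≤ K₀ := by rw [hK₀def]; positivity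
    have hyβ : y ^ β ≤ y := (Real.rpow_le_rpow_of_exponent_le hy1 hβ1.le).trans_eq (Real.rpow_one y)
    have hK₀le : K₀ ≤ 2 * y / L' := by
      rw [hK₀def, div_le_div_iff₀ (by positivity) hL'0]
      nlinarith [mul_le_mul_of_nonneg_right hyβ hL'0.le, mul_nonneg (mul_nonneg hy0 hL'0.le) (by linarith : (0 : ℝ) ≤ 2 * β - 1)]
    -- the tail `T = Σ_{r > √⌊y⌋} g r ≤ 2/√(√⌊y⌋) ≤ 1/(3k⁴)`
    obtain ⟨T, hT⟩ : ∃ T : ℝ, T = ∑' i, g (i + (Nat.sqrt ⌊y⌋₊ + 1)) := ⟨_, rfl⟩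
    have hT0 : 0 ≤ T := hT ▸ tsum_nonneg fun i => hg0 _
    have hTle : T ≤ 2 / Real.sqrt (Nat.sqrt ⌊y⌋₊) := hT ▸ tr_tail_le hβ34 hg0 hgle hS₀1
    have hST : ∑ r ∈ Ioc 0 (Nat.sqrt ⌊y⌋₊), g r + T = S := by
      have hIcc : Icc 1 (Nat.sqrt ⌊y⌋₊) = Ioc 0 (Nat.sqrt ⌊y⌋₊) := rfl
      rw [hT, hS, ← hgs.sum_add_tsum_nat_add (Nat.sqrt ⌊y⌋₊ + 1), Finset.sum_range_eq_add_Ico _ (by omega : 0 < Nat.sqrt ⌊y⌋₊ + 1),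
        hg00, zero_add, Finset.Ico_add_one_right_eq_Icc, hIcc]
    have hmain : (((S / L') * y ^ β / β : ℝ) : ℂ) = ∑ r ∈ Ioc 0 (Nat.sqrt ⌊y⌋₊), ((K₀ * g r : ℝ) : ℂ) + ((K₀ * T : ℝ) : ℂ) := by
      rw [← Complex.ofReal_sum, ← Complex.ofReal_add, ← Finset.mul_sum, ← mul_add, hST, hK₀def]
      congr 1
      field_simp
    -- per `r`: `ψ(r²) Mtw ψ (y/r²) − K₀ g r = [(r,k)=1] · (Mtw ψ (y/r²) − (y/r²)^β/(β L'))`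
    have hw := tr_psi_sq_apply hψ2
    have hrpow : ∀ r : ℕ, (r : ℝ) ^ (-(2 * β)) = (((r : ℝ) ^ 2) ^ β)⁻¹ := fun r => by
      rw [Real.rpow_neg (Nat.cast_nonneg r), Real.rpow_mul (Nat.cast_nonneg r), Real.rpow_two]
    have hper : ∀ r ∈ Ioc 0 (Nat.sqrt ⌊y⌋₊), ‖ψ ((r * r : ℕ) : ZMod k) * Mtw ψ (y / (r : ℝ) ^ 2) - ((K₀ * g r : ℝ) : ℂ)‖ ≤
        ‖Mtw ψ (y / (r : ℝ) ^ 2) - (((y / (r : ℝ) ^ 2) ^ β / (β * L') : ℝ) : ℂ)‖ := by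
      intro r _
      rw [hw r, hg r]
      by_cases hcop : r.Coprime k
      · rw [if_pos hcop, if_pos hcop, one_mul, hrpow r, hK₀def, Real.div_rpow hy0 (sq_nonneg _),
          show y ^ β / (β * L') * (((r : ℝ) ^ 2) ^ β)⁻¹ = y ^ β / ((r : ℝ) ^ 2) ^ β / (β * L') by ring]
      · rw [if_neg hcop, if_neg hcop, zero_mul, mul_zero, Complex.ofReal_zero, sub_zero, norm_zero]
        exact norm_nonneg _
    -- the two regimes
    have hp : ∀ r ∈ Ioc 0 (Nat.sqrt ⌊y⌋₊), |(y / (r : ℝ) ^ 2) ^ β / (β * L')| ≤ 2 / L' * (y / (r : ℝ) ^ 2) := by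
      intro r hr
      have hx1 := tr_one_le_div hy0 hr
      have hxβ : (y / (r : ℝ) ^ 2) ^ β ≤ y / (r : ℝ) ^ 2 :=
        (Real.rpow_le_rpow_of_exponent_le hx1 hβ1.le).trans_eq (Real.rpow_one _)
      rw [abs_of_nonneg (by positivity), div_le_iff₀ (by positivity),
        show 2 / L' * (y / (r : ℝ) ^ 2) * (β * L') = 2 * β * (y / (r : ℝ) ^ 2) by field_simp]
      have P : 0 ≤ y / (r : ℝ) ^ 2 * (2 * β - 1) := mul_nonneg (by linarith) (by linarith)
      linarith only [hxβ, P]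
    have hlaw : ∀ r ∈ Ioc 0 (Nat.sqrt ⌊y⌋₊), r ≤ 8 * k ^ 4 →
        ‖Mtw ψ (y / (r : ℝ) ^ 2) - (((y / (r : ℝ) ^ 2) ^ β / (β * L') : ℝ) : ℂ)‖ ≤ y / (r : ℝ) ^ 2 / (k : ℝ) ^ 6 :=
      fun r hr hr8 => hExc _ (tr_X₀_le_div (mem_Ioc.1 hr).1 hr8 (Real.exp_pos _).le hy64)
    have hsum := tr_sum_norm_sub_le ψ (fun r => (y / (r : ℝ) ^ 2) ^ β / (β * L')) hy0 hL'0 hp hlaw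
    -- assembling
    have hdecomp : ∑ r ∈ Ioc 0 (Nat.sqrt ⌊y⌋₊), ψ ((r * r : ℕ) : ZMod k) * Mtw ψ (y / (r : ℝ) ^ 2) - (((S / L') * y ^ β / β : ℝ) : ℂ) =
        ∑ r ∈ Ioc 0 (Nat.sqrt ⌊y⌋₊), (ψ ((r * r : ℕ) : ZMod k) * Mtw ψ (y / (r : ℝ) ^ 2) - ((K₀ * g r : ℝ) : ℂ)) -
          ((K₀ * T : ℝ) : ℂ) := by
      rw [hmain, Finset.sum_sub_distrib]; ring
    rw [hdecomp]
    calc ‖∑ r ∈ Ioc 0 (Nat.sqrt ⌊y⌋₊), (ψ ((r * r : ℕ) : ZMod k) * Mtw ψ (y / (r : ℝ) ^ 2) - ((K₀ * g r : ℝ) : ℂ)) -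
          ((K₀ * T : ℝ) : ℂ)‖
        ≤ ‖∑ r ∈ Ioc 0 (Nat.sqrt ⌊y⌋₊), (ψ ((r * r : ℕ) : ZMod k) * Mtw ψ (y / (r : ℝ) ^ 2) - ((K₀ * g r : ℝ) : ℂ))‖ +
          ‖((K₀ * T : ℝ) : ℂ)‖ := norm_sub_le _ _
      _ ≤ ∑ r ∈ Ioc 0 (Nat.sqrt ⌊y⌋₊), ‖Mtw ψ (y / (r : ℝ) ^ 2) - (((y / (r : ℝ) ^ 2) ^ β / (β * L') : ℝ) : ℂ)‖ + K₀ * T := by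
          refine add_le_add ((norm_sum_le _ _).trans (sum_le_sum hper)) (le_of_eq ?_)
          rw [Complex.norm_real, Real.norm_of_nonneg (by positivity)]
      _ ≤ (2 * (y / (k : ℝ) ^ 6) + (1 + 2 / L') * y * (1 / (8 * (k : ℝ) ^ 4))) + (2 * y / L') * (2 / (6 * (k : ℝ) ^ 4)) := by
          refine add_le_add hsum ((mul_le_mul hK₀le hTle hT0 (by positivity)).trans ?_)
          exact mul_le_mul_of_nonneg_left (div_le_div_of_nonneg_left (by norm_num) (by positivity) hsqrt) (by positivity)
      _ ≤ (S / L' + 1) * y / (k : ℝ) ^ 4 := by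
          rw [eA, eR, show (2 * y / L') * (2 / (6 * (k : ℝ) ^ 4)) = 2 / 3 * (y / (k : ℝ) ^ 4 / L') by ring]
          linarith
  · -- a non-exceptional character: no main term
    rw [if_neg hΞ, sub_zero]
    have hp : ∀ r ∈ Ioc 0 (Nat.sqrt ⌊y⌋₊), |(0 : ℝ)| ≤ 2 / L' * (y / (r : ℝ) ^ 2) := fun r _ => by rw [abs_zero]; positivity
    have hlaw : ∀ r ∈ Ioc 0 (Nat.sqrt ⌊y⌋₊), r ≤ 8 * k ^ 4 → ‖Mtw Ξ (y / (r : ℝ) ^ 2) - ((0 : ℝ) : ℂ)‖ ≤ y / (r : ℝ) ^ 2 / (k : ℝ) ^ 6 := by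
      intro r hr hr8
      rw [Complex.ofReal_zero, sub_zero]
      exact hNon Ξ hΞ _ (tr_X₀_le_div (mem_Ioc.1 hr).1 hr8 (Real.exp_pos _).le hy64)
    have hsum := tr_sum_norm_sub_le Ξ (fun _ => (0 : ℝ)) hy0 hL'0 hp hlaw
    simp only [Complex.ofReal_zero, sub_zero] at hsum
    calc ‖∑ r ∈ Ioc 0 (Nat.sqrt ⌊y⌋₊), Ξ ((r * r : ℕ) : ZMod k) * Mtw Ξ (y / (r : ℝ) ^ 2)‖
        ≤ ∑ r ∈ Ioc 0 (Nat.sqrt ⌊y⌋₊), ‖Mtw Ξ (y / (r : ℝ) ^ 2)‖ := by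
          refine (norm_sum_le _ _).trans (sum_le_sum fun r _ => ?_)
          rw [norm_mul]
          exact (mul_le_mul_of_nonneg_right (DirichletCharacter.norm_le_one Ξ _) (norm_nonneg _)).trans_eq (one_mul _)
      _ ≤ 2 * (y / (k : ℝ) ^ 6) + (1 + 2 / L') * y * (1 / (8 * (k : ℝ) ^ 4)) := hsum
      _ ≤ (S / L' + 1) * y / (k : ℝ) ^ 4 := by
          rw [eA, eR]
          linarith

/-- **Transfer of the Möbius laws to the Liouville twisted sums** (`λ = 𝟙_□ ∗ μ`):
`MoebiusLaws → CharTwist`.  The constants: `c₁ ↦ min c₁ (1/4)` (so that the exceptional zero has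
`β ≥ 3/4`, which makes `Σ r^{-2β}` summable with an explicit tail), `C₁ ↦ C₁ + 30`, `C₂ ↦ C₂`. -/
theorem charTwist_of_moebiusLaws (h : MoebiusLaws) : CharTwist := by
  obtain ⟨c₁, C₁, C₂, hc₁, hC₁, hC₂, hE, hN⟩ := h
  refine ⟨min c₁ (1 / 4), C₁ + 30, C₂, lt_min hc₁ (by norm_num), by linarith, hC₂, ?_⟩
  exact tr_charTwistLaw hC₁ hC₂ (lt_min hc₁ (by norm_num)) (min_le_right _ _)
    (hE.mono (min_le_left _ _) le_rfl) (hN.mono (min_le_left _ _) le_rfl)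

end Summit.Parity.GeneralizedHardyLittlewood.Theorems.DilatedChowla.Negative

end
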